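import Mathlib
import Summits.Ventures.LatticeQCDFlow.Scoring.LagProductCovariance
import Summits.Ventures.LatticeQCDFlow.Scoring.FejerPairSums
import Summits.Ventures.LatticeQCDFlow.Scoring.BartlettKernel
import HarnessLib

/-!
# Bartlett's GENERAL formula: for a fourth-order stationary process `N · cov[Γ̂_N(s), Γ̂_N(t)] → B(s,t) + Σ_m κ_{s,t}(m)` — the fourth-cumulant term the Gaussian bar ignores

HONEST FRAMING: exact (Metropolis-corrected) sampling algorithms for lattice gauge theory;
figures of merit are autocorrelation/cost numbers at stated couplings and volumes; no
continuum-physics claim.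

Venture `LatticeQCDFlow` (cell pub-lqcd), sub-topic `Scoring`; FANOUT row 16 (`su2-base`), GEN-6.
NEW WORK of the cell over this packet (`LagProductCovariance.acovHat`, `FejerPairSums`,
`BartlettKernel`).  Nothing is cited as a fact.  Printed counterparts, NAMED ONLY: Bartlett 1946;
Priestley 1981 §5.3.3 eq. (5.3.22) (the term `κ₄ Σ …` for non-Gaussian linear processes);
Anderson 1971 Thm 8.2.?; Madras–Sokal 1988 App. C (who note the Gaussian simplification).

Tenth file of the ERROR-OF-THE-ERROR packet — its honesty clause.  Everything before assumed the
WICK structure of fourth moments (Gaussian data).  Row 16 scores `τ_int(Q_L²)` and `τ_int` of the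
plaquette: neither series is Gaussian.  Here the Gaussian hypothesis is dropped: for a process that
is stationary to FOURTH order — `E[XᵢXⱼ] = c(j−i)` and `E[Xᵢ X_{i+s} Xⱼ X_{j+t}] = m₄(s, j−i, t)` —
the exact finite-`N` covariance of the empirical autocovariances and its `N → ∞` limit hold with ONE
extra term, the summed fourth CUMULANT `κ_{s,t}(m) = m₄(s,m,t) − c(s)c(t) − c(m)c(m+t−s) − c(m+t)c(m−s)`:

* `IsStationaryFour X c m4 μ` (hypothesis structure); `cumulantSummand c m4 s t m = κ_{s,t}(m)`;
* **`IsStationaryFour.covariance_acovHat`** — EXACT: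
  `cov[Γ̂_N(s), Γ̂_N(t)] = N⁻² Σ_{i,j<N} (g_{s,t}(j−i) + κ_{s,t}(j−i))` (`g` = `bartlettSummand`);
* **`IsStationaryFour.tendsto_covariance_acovHat`** — if `c` and `κ_{s,t}` are summable over `ℤ`:
  `N · cov[Γ̂_N(s), Γ̂_N(t)] → B(s,t) + Σ_{m∈ℤ} κ_{s,t}(m)` (Fejér limit; no moment condition);
* `IsWickFamily.isStationaryFour`, **`IsWickFamily.cumulantSummand_eq_zero`** — a stationary Wick
  family is fourth-order stationary with `κ ≡ 0`: the Gaussian files are the `κ = 0` case, and the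
  size of `Σ_m κ_{s,t}(m)` relative to `B(s,t)` is exactly what the printed bars do not see.

NOT CLAIMED: any bound on `κ` for the cell's observables (it is measurable from the run — a
fourth-moment statistic — but no number is typed); mean subtraction; a CLT.
-/

noncomputable section

open MeasureTheory ProbabilityTheory Finset Filter Topology

namespace Summit.Ventures.LatticeQCDFlow.Scoring

variable {Ω : Type*} {mΩ : MeasurableSpace Ω} {μ : Measure Ω}

/-- A real process is STATIONARY TO FOURTH ORDER (along lag pairs) with covariance function `c`
and fourth-moment function `m4`: lag products are square integrable, `E[XᵢXⱼ] = c(j − i)` and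
`E[Xᵢ X_{i+s} Xⱼ X_{j+t}] = m4 s (j − i) t`. [folklore] -/
@[folklore]
structure IsStationaryFour (X : ℕ → Ω → ℝ) (c : ℤ → ℝ) (m4 : ℕ → ℤ → ℕ → ℝ) (μ : Measure Ω) :
    Prop where
  /-- lag products are in `L²` -/
  memLp : ∀ i j, MemLp (fun ω => X i ω * X j ω) 2 μ
  /-- second moments are stationary -/
  two : ∀ i j, ∫ ω, X i ω * X j ω ∂μ = c ((j : ℤ) - i)
  /-- fourth moments along lag pairs are stationary -/
  four : ∀ i j s t : ℕ, ∫ ω, X i ω * X (i + s) ω * X j ω * X (j + t) ω ∂μ = m4 s ((j : ℤ) - i) t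

/-- The FOURTH-CUMULANT SUMMAND `κ_{s,t}(m) = m₄(s,m,t) − c(s)c(t) − c(m)c(m+t−s) − c(m+t)c(m−s)`:
what is left of `cov[X₀X_s, X_mX_{m+t}]` after Bartlett's (Gaussian) summand. [ours] -/
def cumulantSummand (c : ℤ → ℝ) (m4 : ℕ → ℤ → ℕ → ℝ) (s t : ℕ) (m : ℤ) : ℝ :=
  m4 s m t - c s * c t - bartlettSummand c s t m

/-- Unfolding lemma for `cumulantSummand`. -/
theorem cumulantSummand_def (c : ℤ → ℝ) (m4 : ℕ → ℤ → ℕ → ℝ) (s t : ℕ) (m : ℤ) :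
    cumulantSummand c m4 s t m = m4 s m t - c s * c t - bartlettSummand c s t m := rfl

namespace IsStationaryFour

variable {X : ℕ → Ω → ℝ} {c : ℤ → ℝ} {m4 : ℕ → ℤ → ℕ → ℝ}

/-- `Γ̂_N(t)` is square integrable. -/
theorem memLp_acovHat (h : IsStationaryFour X c m4 μ) (N t : ℕ) : MemLp (acovHat X N t) 2 μ := by
  have hs : MemLp (fun ω => ∑ i ∈ range N, X i ω * X (i + t) ω) 2 μ :=
    memLp_finsetSum _ fun i _ => h.memLp i (i + t)
  have heq : acovHat X N t = fun ω => (∑ i ∈ range N, X i ω * X (i + t) ω) * (1 / (N : ℝ)) := by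
    funext ω
    rw [acovHat_apply, div_eq_mul_one_div]
  rw [heq]
  exact hs.mul_const _

/-- **The covariance of two lag products, fourth-order stationary case**:
`cov[XᵢX_{i+s}, XⱼX_{j+t}] = g_{s,t}(j−i) + κ_{s,t}(j−i)`. -/
theorem covariance_mul_mul [IsProbabilityMeasure μ] (h : IsStationaryFour X c m4 μ) (i j s t : ℕ) :
    cov[fun ω => X i ω * X (i + s) ω, fun ω => X j ω * X (j + t) ω; μ]
      = bartlettSummand c s t ((j : ℤ) - i) + cumulantSummand c m4 s t ((j : ℤ) - i) := by
  rw [covariance_eq_sub (h.memLp i (i + s)) (h.memLp j (j + t))]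
  have h4 : ∫ ω, ((fun ω => X i ω * X (i + s) ω) * fun ω => X j ω * X (j + t) ω) ω ∂μ
      = m4 s ((j : ℤ) - i) t := by
    rw [← h.four i j s t]
    refine integral_congr_ae (Filter.Eventually.of_forall fun ω => ?_)
    simp only [Pi.mul_apply]
    ring
  have h2 : ∫ ω, (fun ω => X i ω * X (i + s) ω) ω ∂μ = c s := by
    rw [show (∫ ω, (fun ω => X i ω * X (i + s) ω) ω ∂μ) = ∫ ω, X i ω * X (i + s) ω ∂μ from rfl,
      h.two i (i + s)]
    congr 1
    push_cast
    ring
  have h2' : ∫ ω, (fun ω => X j ω * X (j + t) ω) ω ∂μ = c t := by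
    rw [show (∫ ω, (fun ω => X j ω * X (j + t) ω) ω ∂μ) = ∫ ω, X j ω * X (j + t) ω ∂μ from rfl,
      h.two j (j + t)]
    congr 1
    push_cast
    ring
  rw [h4, h2, h2', cumulantSummand]
  ring

/-- **Exact finite-`N` covariance, fourth-order stationary case**:
`cov[Γ̂_N(s), Γ̂_N(t)] = N⁻² Σ_{i,j<N} (g_{s,t}(j−i) + κ_{s,t}(j−i))`. -/
theorem covariance_acovHat [IsProbabilityMeasure μ] (h : IsStationaryFour X c m4 μ) (N s t : ℕ) :
    cov[acovHat X N s, acovHat X N t; μ]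
      = (∑ i ∈ range N, ∑ j ∈ range N,
          (bartlettSummand c s t ((j : ℤ) - i) + cumulantSummand c m4 s t ((j : ℤ) - i)))
        / (N : ℝ) ^ 2 := by
  unfold acovHat
  rw [covariance_fun_div_left, covariance_fun_div_right,
    covariance_fun_sum_fun_sum' (fun i _ => h.memLp i (i + s)) (fun j _ => h.memLp j (j + t))]
  simp_rw [h.covariance_mul_mul]
  rw [div_div, ← sq]

/-- **Bartlett's general formula.**  If `c` and the cumulant summand `κ_{s,t}` are summable over
`ℤ`, then `N · cov[Γ̂_N(s), Γ̂_N(t)] → B(s,t) + Σ_{m∈ℤ} κ_{s,t}(m)`. -/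
theorem tendsto_covariance_acovHat [IsProbabilityMeasure μ] (h : IsStationaryFour X c m4 μ)
    (hc : Summable c) (s t : ℕ) (hκ : Summable (cumulantSummand c m4 s t)) :
    Tendsto (fun N : ℕ => (N : ℝ) * cov[acovHat X N s, acovHat X N t; μ]) atTop
      (𝓝 (bartlettKernel c s t + ∑' m, cumulantSummand c m4 s t m)) := by
  have hsum : Summable fun m => bartlettSummand c s t m + cumulantSummand c m4 s t m :=
    (summable_bartlettSummand hc s t).add hκ
  have hlim := tendsto_sum_sum_int_sub_div hsum
  rw [(summable_bartlettSummand hc s t).tsum_add hκ, tsum_bartlettSummand hc s t] at hlim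
  refine hlim.congr fun N => ?_
  rw [h.covariance_acovHat, IsWickFamily.natCast_mul_div_sq]

/-- In particular `N · Var[Γ̂_N(t)] → K(0) + K(2t) + Σ_m κ_{t,t}(m)`. -/
theorem tendsto_variance_acovHat [IsProbabilityMeasure μ] (h : IsStationaryFour X c m4 μ)
    (hc : Summable c) (t : ℕ) (hκ : Summable (cumulantSummand c m4 t t)) :
    Tendsto (fun N : ℕ => (N : ℝ) * Var[acovHat X N t; μ]) atTop
      (𝓝 (bartlettKernel c t t + ∑' m, cumulantSummand c m4 t t m)) := by
  refine (h.tendsto_covariance_acovHat hc t t hκ).congr fun N => ?_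
  rw [covariance_self (h.memLp_acovHat N t).aestronglyMeasurable.aemeasurable]

end IsStationaryFour

/-! ## The Gaussian case is `κ ≡ 0` -/

namespace IsWickFamily

variable {X : ℕ → Ω → ℝ} {C : ℕ → ℕ → ℝ} {c : ℤ → ℝ}

/-- The fourth-moment function of a stationary Wick family: the three pairings. [ours] -/
def wickFour (c : ℤ → ℝ) (s : ℕ) (m : ℤ) (t : ℕ) : ℝ :=
  c s * c t + c m * c (m + t - s) + c (m + t) * c (m - s)

/-- A stationary Wick family is stationary to fourth order, with `m₄ = wickFour c`. -/
theorem isStationaryFour (h : IsWickFamily X C μ) (hC : ∀ i j, C i j = c ((j : ℤ) - i)) :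
    IsStationaryFour X c (wickFour c) μ where
  memLp := h.memLp
  two i j := by rw [h.two, hC]
  four i j s t := by
    rw [h.four, hC, hC, hC, hC, hC, hC, wickFour]
    have e1 : (((i + s : ℕ) : ℤ) - (i : ℤ)) = s := by push_cast; ring
    have e2 : (((j + t : ℕ) : ℤ) - (j : ℤ)) = t := by push_cast; ring
    have e3 : (((j + t : ℕ) : ℤ) - ((i + s : ℕ) : ℤ)) = (j : ℤ) - i + t - s := by push_cast; ring
    have e4 : (((j + t : ℕ) : ℤ) - (i : ℤ)) = (j : ℤ) - i + t := by push_cast; ring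
    have e5 : ((j : ℤ) - ((i + s : ℕ) : ℤ)) = (j : ℤ) - i - s := by push_cast; ring
    rw [e1, e2, e3, e4, e5]

/-- **For Gaussian (Wick) data the fourth-cumulant summand vanishes identically.** -/
theorem cumulantSummand_eq_zero (c : ℤ → ℝ) (s t : ℕ) (m : ℤ) :
    cumulantSummand c (wickFour c) s t m = 0 := by
  rw [cumulantSummand, wickFour, bartlettSummand]
  ring

/-- Consistency: the general formula with `κ ≡ 0` is the Gaussian one
(`BartlettKernel.tendsto_covariance_acovHat'`). -/
theorem tendsto_covariance_acovHat_general [IsProbabilityMeasure μ] (h : IsWickFamily X C μ)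
    (hC : ∀ i j, C i j = c ((j : ℤ) - i)) (hc : Summable c) (s t : ℕ) :
    Tendsto (fun N : ℕ => (N : ℝ) * cov[acovHat X N s, acovHat X N t; μ]) atTop
      (𝓝 (bartlettKernel c s t + ∑' m, cumulantSummand c (wickFour c) s t m)) := by
  refine (h.isStationaryFour hC).tendsto_covariance_acovHat hc s t ?_
  have : cumulantSummand c (wickFour c) s t = fun _ => 0 := funext (cumulantSummand_eq_zero c s t)
  rw [this]
  exact summable_zero

end IsWickFamily

end Summit.Ventures.LatticeQCDFlow.Scoring
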